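import Summits.ValiantsHypothesis.ValiantsHypothesis.Theorems.LacunarySymmetroidMatrixDescartesPivotDeflationPassage

/-!
# `MatrixDescartes` census — DEFLATION OVERLAP LAW for `2 × 2` pivot pencils (pivot column, m = 2)

HONEST FRAMING.  Structure theorems for the object-search cell `pub-symmetroid`'s pivot column
(`…CensusPivotDefs`: `pivotPosRoots`, `PivotRootLawAt`; the open m = 2 row «(2,K) ≤ 2K», located cell
(2,4)₁ ∈ {8,9,10}).  Landed `--supports stmt-ValiantsHypothesis-18050` as a helper; it proves NO bound on any
pivot row and says nothing about `Theses.LacunarySymmetroid.MatrixDescartes`, DoorA26/DoorA34, the census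
registers or `VP ≠ VNP`.

THE LAW.  `F(X) = X^e • J + ∑ₖ X^{d k} • P k`, all `P k ⪰ 0`; for a level `D` the deflated pencil is
`F̃_D(u) = (D − e) u^e • J + ∑ₖ (D − d k) u^{d k} • P k` (`…PivotDeflationPassage`).  For two levels `D₋ < D₊`
the pencil is a positive combination of its two deflations,
`(D₊ − D₋) · F(u) = F̃_{D₊}(u) − F̃_{D₋}(u)` (`deflate_sub_deflate`, on every direction: `quadForm_deflate_sub`),
so (`neg_of_overlap`) a direction `v` on which, at one time `u`, the `D₊`-deflation is negative AND the
`D₋`-deflation is positive (for `D₋ = min d k < e < D₊ = max d k`: the top-deflated and the bottom-deflated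
`(K−1)`-letter pivot pencils are BOTH negative on `v` at `u`) is a negative direction of `F(u)`.  CONVERSELY
(`exists_overlap_of_neg`): if `D₋ < e < D₊`, `D₋ ≤ d k ≤ D₊`, and `v` is a negative direction of `F(u₀)` for some
`u₀ > 0`, then at some `u > 0` the `D₊`-deflation is negative and the `D₋`-deflation positive on `v` — namely at a
minimiser of `u ↦ vᵀF(u)v / u^e` when the letters charge `v` on both sides of the pivot exponent (there
`u·(vᵀF v)'(u) = e·vᵀF(u)v`, so `vᵀF̃_D(u)v = (D − e)·vᵀF(u)v` for every `D`), and far out / close to `0` otherwise.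

READING (directional islands, m = 2 row): a direction carries an island of the `K`-letter pencil iff the islands of
its top and bottom `(K−1)`-letter deflations in that direction OVERLAP IN TIME; with the passage law (`≤ 1` root
per gap) and `…DeflationNesting` (crossings inside deflated islands) this locates every re-entry of a deflated
island inside the time-overlap of the two deflations.  Nothing is claimed about the number of such overlaps.

[folklore] Euler's identity, Fermat's stationarity at an interior minimum, elementary estimates for posynomials.
-/

-- `Summit.ValiantsHypothesis.ValiantsHypothesis.…` repeats a component by the D-0017 layout
-- (single-conjunct summit), which the `dupNamespace` linter flags; the name is mandated.
set_option linter.dupNamespace false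

namespace Summit.ValiantsHypothesis.ValiantsHypothesis.Theorems.LacunarySymmetroidMatrixDescartes.Pivot.Overlap

open Polynomial Matrix Finset
open scoped BigOperators
open Summit.ValiantsHypothesis.ValiantsHypothesis.Theorems.LacunarySymmetroidMatrixDescartes.Pivot.Deflation

variable {K : ℕ}

/-! ## The pencil is a positive combination of two deflations -/

/-- `F̃_{D₊}(u) − F̃_{D₋}(u) = (D₊ − D₋) • F(u)` for any two levels. [elementary] -/
theorem deflate_sub_deflate (e D₁ D₂ : ℕ) (d : Fin K → ℕ) (J : Matrix (Fin 2) (Fin 2) ℝ)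
    (P : Fin K → Matrix (Fin 2) (Fin 2) ℝ) (u : ℝ) :
    ((((D₁ : ℝ) - e) * u ^ e) • J + ∑ k, (((D₁ : ℝ) - d k) * u ^ d k) • P k)
      - ((((D₂ : ℝ) - e) * u ^ e) • J + ∑ k, (((D₂ : ℝ) - d k) * u ^ d k) • P k)
      = ((D₁ : ℝ) - D₂) • (u ^ e • J + ∑ k, u ^ d k • P k) := by
  rw [smul_add, Finset.smul_sum, add_sub_add_comm, ← Finset.sum_sub_distrib, ← sub_smul]
  congr 1
  · rw [smul_smul]; congr 1; ring
  · refine Finset.sum_congr rfl fun k _ => ?_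
    rw [← sub_smul, smul_smul]; congr 1; ring

/-- The same identity on a direction `v`:
`vᵀF̃_{D₁}(u)v − vᵀF̃_{D₂}(u)v = (D₁ − D₂) · vᵀF(u)v`. -/
theorem quadForm_deflate_sub (e D₁ D₂ : ℕ) (d : Fin K → ℕ) (J : Matrix (Fin 2) (Fin 2) ℝ)
    (P : Fin K → Matrix (Fin 2) (Fin 2) ℝ) (u : ℝ) (v : Fin 2 → ℝ) :
    dotProduct v (((((D₁ : ℝ) - e) * u ^ e) • J + ∑ k, (((D₁ : ℝ) - d k) * u ^ d k) • P k).mulVec v)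
      - dotProduct v (((((D₂ : ℝ) - e) * u ^ e) • J + ∑ k, (((D₂ : ℝ) - d k) * u ^ d k) • P k).mulVec v)
      = ((D₁ : ℝ) - D₂) * dotProduct v ((u ^ e • J + ∑ k, u ^ d k • P k).mulVec v) := by
  rw [← dotProduct_sub, ← Matrix.sub_mulVec, deflate_sub_deflate, Matrix.smul_mulVec, dotProduct_smul,
    smul_eq_mul]

/-- **OVERLAP ⟹ ISLAND (pointwise).**  If at the time `u` the `D₊`-deflated pencil is negative on `v` and the
`D₋`-deflated pencil is positive on `v` (`D₋ < D₊`; for `D₋ = min d k`, `D₊ = max d k` this says that the top- and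
the bottom-deflated `(K−1)`-letter pivot pencils are both negative on `v` at `u`), then `F(u)` is negative on `v`. -/
theorem neg_of_overlap (e Dm Dp : ℕ) (d : Fin K → ℕ) (J : Matrix (Fin 2) (Fin 2) ℝ)
    (P : Fin K → Matrix (Fin 2) (Fin 2) ℝ) (hD : Dm < Dp) (u : ℝ) (v : Fin 2 → ℝ)
    (htop : dotProduct v (((((Dp : ℝ) - e) * u ^ e) • J + ∑ k, (((Dp : ℝ) - d k) * u ^ d k) • P k).mulVec v) < 0)
    (hbot : 0 < dotProduct v (((((Dm : ℝ) - e) * u ^ e) • J + ∑ k, (((Dm : ℝ) - d k) * u ^ d k) • P k).mulVec v)) :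
    dotProduct v ((u ^ e • J + ∑ k, u ^ d k • P k).mulVec v) < 0 := by
  have h := quadForm_deflate_sub e Dp Dm d J P u v
  have hpos : (0 : ℝ) < (Dp : ℝ) - Dm := sub_pos.2 (by exact_mod_cast hD)
  have : ((Dp : ℝ) - Dm) * dotProduct v ((u ^ e • J + ∑ k, u ^ d k • P k).mulVec v) < 0 := by
    rw [← h]; linarith
  by_contra h'
  exact absurd this (not_lt.2 (mul_nonneg hpos.le (not_lt.1 h')))

/-! ## The converse: a negative direction is witnessed by a simultaneous time -/

/-- **Euler at a stationary point.**  If `u > 0` is a stationary point of `u ↦ vᵀF(u)v / u^e` then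
`vᵀF̃_D(u)v = (D − e) · vᵀF(u)v` for every level `D`. -/
theorem quadForm_deflate_of_stationary (e D : ℕ) (d : Fin K → ℕ) (J : Matrix (Fin 2) (Fin 2) ℝ)
    (P : Fin K → Matrix (Fin 2) (Fin 2) ℝ) (v : Fin 2 → ℝ) {u : ℝ} (hu : 0 < u)
    (hstat : deriv (fun u : ℝ => dotProduct v ((u ^ e • J + ∑ k, u ^ d k • P k).mulVec v) / u ^ e) u = 0) :
    dotProduct v (((((D : ℝ) - e) * u ^ e) • J + ∑ k, (((D : ℝ) - d k) * u ^ d k) • P k).mulVec v)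
      = ((D : ℝ) - e) * dotProduct v ((u ^ e • J + ∑ k, u ^ d k • P k).mulVec v) := by
  -- the `e`-deflated form vanishes at a stationary point of `vᵀFv / u^e`
  have h0 := (Passage.hasDerivAt_quadForm_div_pow e e d J P v hu).deriv
  rw [hstat] at h0
  have hE : dotProduct v (((((e : ℝ) - e) * u ^ e) • J + ∑ k, (((e : ℝ) - d k) * u ^ d k) • P k).mulVec v) = 0 := by
    have hne : u ^ (e + 1) ≠ 0 := pow_ne_zero _ hu.ne'
    rcases (div_eq_zero_iff.1 h0.symm) with h1 | h1
    · exact neg_eq_zero.1 h1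
    · exact absurd h1 hne
  have h := quadForm_deflate_sub e D e d J P u v
  rw [hE, sub_zero] at h
  exact h

/-- The directional form written out: `vᵀF(u)v = u^e · vᵀJv + ∑ u^{d k} · vᵀP_kv`. -/
theorem quadForm_pencil_eq (e : ℕ) (d : Fin K → ℕ) (J : Matrix (Fin 2) (Fin 2) ℝ)
    (P : Fin K → Matrix (Fin 2) (Fin 2) ℝ) (v : Fin 2 → ℝ) (u : ℝ) :
    dotProduct v ((u ^ e • J + ∑ k, u ^ d k • P k).mulVec v)
      = u ^ e * dotProduct v (J.mulVec v) + ∑ k, u ^ d k * dotProduct v ((P k).mulVec v) :=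
  quadForm_comb (u ^ e) (fun k => u ^ d k) J P v

/-- The deflated directional form written out. -/
theorem quadForm_deflate_eq (e D : ℕ) (d : Fin K → ℕ) (J : Matrix (Fin 2) (Fin 2) ℝ)
    (P : Fin K → Matrix (Fin 2) (Fin 2) ℝ) (v : Fin 2 → ℝ) (u : ℝ) :
    dotProduct v (((((D : ℝ) - e) * u ^ e) • J + ∑ k, (((D : ℝ) - d k) * u ^ d k) • P k).mulVec v)
      = ((D : ℝ) - e) * u ^ e * dotProduct v (J.mulVec v)
        + ∑ k, ((D : ℝ) - d k) * u ^ d k * dotProduct v ((P k).mulVec v) :=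
  quadForm_comb _ _ J P v

/-! ### Scalar estimates for `g̃_D(u) = (D − e)u^e·cJ + ∑ (D − d k)u^{d k}·c k` -/

/-- `|D − d k| ≤ Dp − Dm` for `Dm ≤ D, d k ≤ Dp`. -/
theorem abs_level_sub_le {D Dm Dp dk : ℕ} (hD : Dm ≤ D ∧ D ≤ Dp) (hd : Dm ≤ dk ∧ dk ≤ Dp) :
    |((D : ℝ) - dk)| ≤ (Dp : ℝ) - Dm := by
  rw [abs_sub_le_iff]
  have h1 : (D : ℝ) ≤ Dp := by exact_mod_cast hD.2
  have h2 : (Dm : ℝ) ≤ dk := by exact_mod_cast hd.1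
  have h3 : (Dm : ℝ) ≤ D := by exact_mod_cast hD.1
  have h4 : (dk : ℝ) ≤ Dp := by exact_mod_cast hd.2
  constructor <;> linarith

/-- Uniform bound on the letter part of a deflated form when every charged letter has exponent `≤ e − 1`
and `u ≥ 1`: `|∑ (D − d k) u^{d k} c k| ≤ (Dp − Dm)·(∑ c k)·u^{e−1}` for `Dm ≤ D, d k ≤ Dp`. -/
theorem abs_letterSum_le_far (e D Dm Dp : ℕ) (d : Fin K → ℕ) (c : Fin K → ℝ) (hc : ∀ k, 0 ≤ c k)
    (hD : Dm ≤ D ∧ D ≤ Dp) (hd : ∀ k, Dm ≤ d k ∧ d k ≤ Dp) (hlow : ∀ k, c k = 0 ∨ d k ≤ e - 1)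
    {u : ℝ} (hu : 1 ≤ u) :
    |∑ k, ((D : ℝ) - d k) * u ^ d k * c k| ≤ ((Dp : ℝ) - Dm) * (∑ k, c k) * u ^ (e - 1) := by
  refine (Finset.abs_sum_le_sum_abs _ _).trans ?_
  rw [Finset.mul_sum, Finset.sum_mul]
  refine Finset.sum_le_sum fun k _ => ?_
  have h1 := abs_level_sub_le hD (hd k)
  have h2 : u ^ d k * c k ≤ u ^ (e - 1) * c k := by
    rcases hlow k with h0 | hdk
    · rw [h0]; simp
    · exact mul_le_mul_of_nonneg_right (pow_le_pow_right₀ hu hdk) (hc k)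
  rw [abs_mul, abs_mul, abs_of_nonneg (hc k), abs_of_nonneg (pow_nonneg (zero_le_one.trans hu) _), mul_assoc]
  calc |((D : ℝ) - d k)| * (u ^ d k * c k) ≤ ((Dp : ℝ) - Dm) * (u ^ (e - 1) * c k) :=
        mul_le_mul h1 h2 (mul_nonneg (pow_nonneg (zero_le_one.trans hu) _) (hc k)) ((abs_nonneg _).trans h1)
    _ = ((Dp : ℝ) - Dm) * c k * u ^ (e - 1) := by ring

/-- The mirror bound when every charged letter has exponent `≥ e + 1` and `0 ≤ u ≤ 1`:
`|∑ (D − d k) u^{d k} c k| ≤ (Dp − Dm)·(∑ c k)·u^{e+1}`. -/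
theorem abs_letterSum_le_near (e D Dm Dp : ℕ) (d : Fin K → ℕ) (c : Fin K → ℝ) (hc : ∀ k, 0 ≤ c k)
    (hD : Dm ≤ D ∧ D ≤ Dp) (hd : ∀ k, Dm ≤ d k ∧ d k ≤ Dp) (hhigh : ∀ k, c k = 0 ∨ e + 1 ≤ d k)
    {u : ℝ} (hu0 : 0 ≤ u) (hu : u ≤ 1) :
    |∑ k, ((D : ℝ) - d k) * u ^ d k * c k| ≤ ((Dp : ℝ) - Dm) * (∑ k, c k) * u ^ (e + 1) := by
  refine (Finset.abs_sum_le_sum_abs _ _).trans ?_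
  rw [Finset.mul_sum, Finset.sum_mul]
  refine Finset.sum_le_sum fun k _ => ?_
  have h1 := abs_level_sub_le hD (hd k)
  have h2 : u ^ d k * c k ≤ u ^ (e + 1) * c k := by
    rcases hhigh k with h0 | hdk
    · rw [h0]; simp
    · exact mul_le_mul_of_nonneg_right (pow_le_pow_of_le_one hu0 hu hdk) (hc k)
  rw [abs_mul, abs_mul, abs_of_nonneg (hc k), abs_of_nonneg (pow_nonneg hu0 _), mul_assoc]
  calc |((D : ℝ) - d k)| * (u ^ d k * c k) ≤ ((Dp : ℝ) - Dm) * (u ^ (e + 1) * c k) :=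
        mul_le_mul h1 h2 (mul_nonneg (pow_nonneg hu0 _) (hc k)) ((abs_nonneg _).trans h1)
    _ = ((Dp : ℝ) - Dm) * c k * u ^ (e + 1) := by ring

/-- **Far-out overlap.**  If no letter above the pivot exponent charges the direction, a large `u` works. -/
theorem scalar_overlap_far (e Dm Dp : ℕ) (d : Fin K → ℕ) (cJ : ℝ) (c : Fin K → ℝ) (hc : ∀ k, 0 ≤ c k)
    (hcJ : cJ < 0) (hDm : Dm < e) (hDp : e < Dp) (hd : ∀ k, Dm ≤ d k ∧ d k ≤ Dp)
    (hlow : ∀ k, c k = 0 ∨ d k ≤ e - 1) :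
    ∃ u : ℝ, 0 < u ∧
      ((Dp : ℝ) - e) * u ^ e * cJ + ∑ k, ((Dp : ℝ) - d k) * u ^ d k * c k < 0 ∧
      0 < ((Dm : ℝ) - e) * u ^ e * cJ + ∑ k, ((Dm : ℝ) - d k) * u ^ d k * c k := by
  set M := ((Dp : ℝ) - Dm) * ∑ k, c k with hM
  have hM0 : 0 ≤ M := mul_nonneg (sub_nonneg.2 (by exact_mod_cast (hDm.trans hDp).le))
    (Finset.sum_nonneg fun k _ => hc k)
  set u : ℝ := M / (-cJ) + 1 with hu
  have hcJ' : 0 < -cJ := neg_pos.2 hcJ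
  have hu1 : 1 ≤ u := by rw [hu]; linarith [div_nonneg hM0 hcJ'.le]
  have hu0 : 0 < u := by linarith
  have hkey : M < -cJ * u := by rw [hu, mul_add, mul_div_cancel₀ _ hcJ'.ne']; linarith
  have he : u ^ e = u ^ (e - 1) * u := by rw [← pow_succ]; congr 1; omega
  have hp : 0 < u ^ (e - 1) := pow_pos hu0 _
  have hDpe : (1 : ℝ) ≤ (Dp : ℝ) - e := by
    have : ((e : ℝ) + 1) ≤ Dp := by exact_mod_cast (hDp : e + 1 ≤ Dp)
    linarith
  have hDme : (Dm : ℝ) - e ≤ -1 := by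
    have : ((Dm : ℝ) + 1) ≤ e := by exact_mod_cast (hDm : Dm + 1 ≤ e)
    linarith
  refine ⟨u, hu0, ?_, ?_⟩
  · have hS := (abs_le.1 (abs_letterSum_le_far e Dp Dm Dp d c hc ⟨(hDm.trans hDp).le, le_rfl⟩ hd hlow hu1)).2
    have h1 : ((Dp : ℝ) - e) * u ^ e * cJ ≤ u ^ e * cJ := by
      have : 0 ≤ (((Dp : ℝ) - e) - 1) * (u ^ e * (-cJ)) := mul_nonneg (by linarith) (by positivity)
      nlinarith
    have h2 : u ^ e * cJ + M * u ^ (e - 1) < 0 := by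
      rw [he]; nlinarith [mul_lt_mul_of_pos_right hkey hp]
    linarith
  · have hS := (abs_le.1 (abs_letterSum_le_far e Dm Dm Dp d c hc ⟨le_rfl, (hDm.trans hDp).le⟩ hd hlow hu1)).1
    have h1 : u ^ e * (-cJ) ≤ ((Dm : ℝ) - e) * u ^ e * cJ := by
      have : 0 ≤ (-1 - ((Dm : ℝ) - e)) * (u ^ e * (-cJ)) := mul_nonneg (by linarith) (by positivity)
      nlinarith
    have h2 : 0 < u ^ e * (-cJ) - M * u ^ (e - 1) := by
      rw [he]; nlinarith [mul_lt_mul_of_pos_right hkey hp]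
    linarith

/-- **Near-zero overlap.**  If no letter below the pivot exponent charges the direction, a small `u` works. -/
theorem scalar_overlap_near (e Dm Dp : ℕ) (d : Fin K → ℕ) (cJ : ℝ) (c : Fin K → ℝ) (hc : ∀ k, 0 ≤ c k)
    (hcJ : cJ < 0) (hDm : Dm < e) (hDp : e < Dp) (hd : ∀ k, Dm ≤ d k ∧ d k ≤ Dp)
    (hhigh : ∀ k, c k = 0 ∨ e + 1 ≤ d k) :
    ∃ u : ℝ, 0 < u ∧
      ((Dp : ℝ) - e) * u ^ e * cJ + ∑ k, ((Dp : ℝ) - d k) * u ^ d k * c k < 0 ∧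
      0 < ((Dm : ℝ) - e) * u ^ e * cJ + ∑ k, ((Dm : ℝ) - d k) * u ^ d k * c k := by
  set M := ((Dp : ℝ) - Dm) * ∑ k, c k with hM
  have hM0 : 0 ≤ M := mul_nonneg (sub_nonneg.2 (by exact_mod_cast (hDm.trans hDp).le))
    (Finset.sum_nonneg fun k _ => hc k)
  have hcJ' : 0 < -cJ := neg_pos.2 hcJ
  set u : ℝ := (-cJ) / (-cJ + M) with hu
  have hden : 0 < -cJ + M := by linarith
  have hu0 : 0 < u := div_pos hcJ' hden
  have hu1 : u ≤ 1 := by rw [hu, div_le_one hden]; linarith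
  have hkey : M * u < -cJ := by
    rw [hu, ← mul_div_assoc, div_lt_iff₀ hden]; nlinarith
  have he : u ^ (e + 1) = u ^ e * u := pow_succ u e
  have hp : 0 < u ^ e := pow_pos hu0 _
  have hDpe : (1 : ℝ) ≤ (Dp : ℝ) - e := by
    have : ((e : ℝ) + 1) ≤ Dp := by exact_mod_cast (hDp : e + 1 ≤ Dp)
    linarith
  have hDme : (Dm : ℝ) - e ≤ -1 := by
    have : ((Dm : ℝ) + 1) ≤ e := by exact_mod_cast (hDm : Dm + 1 ≤ e)
    linarith
  refine ⟨u, hu0, ?_, ?_⟩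
  · have hS := (abs_le.1 (abs_letterSum_le_near e Dp Dm Dp d c hc ⟨(hDm.trans hDp).le, le_rfl⟩ hd hhigh
      hu0.le hu1)).2
    have h1 : ((Dp : ℝ) - e) * u ^ e * cJ ≤ u ^ e * cJ := by
      have : 0 ≤ (((Dp : ℝ) - e) - 1) * (u ^ e * (-cJ)) := mul_nonneg (by linarith) (by positivity)
      nlinarith
    have h2 : u ^ e * cJ + M * u ^ (e + 1) < 0 := by
      rw [he]; nlinarith [mul_lt_mul_of_pos_left hkey hp]
    linarith
  · have hS := (abs_le.1 (abs_letterSum_le_near e Dm Dm Dp d c hc ⟨le_rfl, (hDm.trans hDp).le⟩ hd hhigh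
      hu0.le hu1)).1
    have h1 : u ^ e * (-cJ) ≤ ((Dm : ℝ) - e) * u ^ e * cJ := by
      have : 0 ≤ (-1 - ((Dm : ℝ) - e)) * (u ^ e * (-cJ)) := mul_nonneg (by linarith) (by positivity)
      nlinarith
    have h2 : 0 < u ^ e * (-cJ) - M * u ^ (e + 1) := by
      rw [he]; nlinarith [mul_lt_mul_of_pos_left hkey hp]
    linarith

/-- **Interior minimiser.**  If the letters charge the direction `v` on BOTH sides of the pivot exponent and
`vᵀF(u₀)v < 0` for some `u₀ > 0`, then `u ↦ vᵀF(u)v / u^e` has a stationary point `τ > 0` with `vᵀF(τ)v < 0`.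
[folklore: extreme value theorem on a compact interval outside which the quotient is non-negative, Fermat] -/
theorem exists_stationary_neg (e : ℕ) (d : Fin K → ℕ) (J : Matrix (Fin 2) (Fin 2) ℝ)
    (P : Fin K → Matrix (Fin 2) (Fin 2) ℝ) (hP : ∀ k, (P k).PosSemidef) (v : Fin 2 → ℝ)
    (kp km : Fin K) (hkp : e < d kp ∧ 0 < dotProduct v ((P kp).mulVec v))
    (hkm : d km < e ∧ 0 < dotProduct v ((P km).mulVec v)) {u₀ : ℝ} (hu₀ : 0 < u₀)
    (hneg : dotProduct v ((u₀ ^ e • J + ∑ k, u₀ ^ d k • P k).mulVec v) < 0) :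
    ∃ τ : ℝ, 0 < τ ∧ dotProduct v ((τ ^ e • J + ∑ k, τ ^ d k • P k).mulVec v) < 0 ∧
      deriv (fun u : ℝ => dotProduct v ((u ^ e • J + ∑ k, u ^ d k • P k).mulVec v) / u ^ e) τ = 0 := by
  set cJ := dotProduct v (J.mulVec v) with hcJdef
  set c : Fin K → ℝ := fun k => dotProduct v ((P k).mulVec v) with hcdef
  have hc : ∀ k, 0 ≤ c k := fun k => by simpa only [hcdef, star_trivial] using (hP k).dotProduct_mulVec_nonneg v
  have hg : ∀ u : ℝ, dotProduct v ((u ^ e • J + ∑ k, u ^ d k • P k).mulVec v)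
      = u ^ e * cJ + ∑ k, u ^ d k * c k := fun u => quadForm_pencil_eq e d J P v u
  -- `cJ < 0`
  have hcJ : cJ < 0 := by
    rw [hg] at hneg
    have : 0 ≤ ∑ k, u₀ ^ d k * c k := Finset.sum_nonneg fun k _ => mul_nonneg (pow_nonneg hu₀.le _) (hc k)
    by_contra h
    linarith [mul_nonneg (pow_nonneg hu₀.le e) (not_lt.1 h)]
  have hcJ' : 0 < -cJ := neg_pos.2 hcJ
  set φ : ℝ → ℝ := fun u => dotProduct v ((u ^ e • J + ∑ k, u ^ d k • P k).mulVec v) / u ^ e with hφ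
  -- non-negativity of the quotient outside `[A, B]`
  have lower : ∀ (u : ℝ) (k₀ : Fin K), 0 < u → u ^ e * (-cJ) ≤ u ^ d k₀ * c k₀ → 0 ≤ φ u := by
    intro u k₀ hu hk
    have hsum : u ^ d k₀ * c k₀ ≤ ∑ k, u ^ d k * c k :=
      Finset.single_le_sum (f := fun k => u ^ d k * c k)
        (fun k _ => mul_nonneg (pow_nonneg hu.le _) (hc k)) (Finset.mem_univ k₀)
    have : 0 ≤ u ^ e * cJ + ∑ k, u ^ d k * c k := by linarith
    simp only [hφ]; rw [hg]
    exact div_nonneg this (pow_nonneg hu.le _)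
  set A : ℝ := min 1 (min u₀ (c km / (-cJ))) / 2 with hA
  set B : ℝ := 2 * max 1 (max u₀ ((-cJ) / c kp)) with hB
  have hA0 : 0 < A := by
    rw [hA]; have := div_pos hkm.2 hcJ'
    have : 0 < min 1 (min u₀ (c km / (-cJ))) := lt_min one_pos (lt_min hu₀ this)
    linarith
  have hAu₀ : A < u₀ := by
    have : min 1 (min u₀ (c km / (-cJ))) ≤ u₀ := (min_le_right _ _).trans (min_le_left _ _)
    rw [hA]; linarith
  have hu₀B : u₀ < B := by
    rw [hB]; linarith [le_max_left u₀ ((-cJ) / c kp), le_max_right (1:ℝ) (max u₀ ((-cJ) / c kp))]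
  have hφA : 0 ≤ φ A := by
    refine lower A km hA0 ?_
    have hA1 : A ≤ 1 := by rw [hA]; linarith [min_le_left (1:ℝ) (min u₀ (c km / (-cJ))), hA0]
    have hAc : A ≤ c km / (-cJ) := by
      rw [hA]
      linarith [min_le_right (1:ℝ) (min u₀ (c km / (-cJ))), min_le_right u₀ (c km / (-cJ)), hA0]
    -- `A^e · (−cJ) = A^{d km} · (A^{e − d km} · (−cJ)) ≤ A^{d km} · (A · (−cJ)) ≤ A^{d km} · c km`
    have h1 : A ^ (e - d km) ≤ A := by
      calc A ^ (e - d km) ≤ A ^ 1 := pow_le_pow_of_le_one hA0.le hA1 (by omega)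
        _ = A := pow_one A
    have h2 : A * (-cJ) ≤ c km := by rwa [le_div_iff₀ hcJ'] at hAc
    have hsplit : A ^ e = A ^ d km * A ^ (e - d km) := by rw [← pow_add]; congr 1; omega
    rw [hsplit, mul_assoc]
    exact mul_le_mul_of_nonneg_left (by nlinarith [pow_nonneg hA0.le (e - d km)]) (pow_nonneg hA0.le _)
  have hB0 : 0 < B := by linarith
  have hφB : 0 ≤ φ B := by
    refine lower B kp hB0 ?_
    have hB1 : 1 ≤ B := by rw [hB]; linarith [le_max_left (1:ℝ) (max u₀ ((-cJ) / c kp))]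
    have hBc : (-cJ) / c kp ≤ B := by
      rw [hB]; linarith [le_max_right u₀ ((-cJ) / c kp), le_max_right (1:ℝ) (max u₀ ((-cJ) / c kp)),
        div_nonneg hcJ'.le hkp.2.le]
    have h1 : B ≤ B ^ (d kp - e) := by
      calc B = B ^ 1 := (pow_one B).symm
        _ ≤ B ^ (d kp - e) := pow_le_pow_right₀ hB1 (by omega)
    have h2 : -cJ ≤ B * c kp := by rwa [div_le_iff₀ hkp.2] at hBc
    have hsplit : B ^ d kp = B ^ e * B ^ (d kp - e) := by rw [← pow_add]; congr 1; omega
    rw [hsplit, mul_assoc]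
    exact mul_le_mul_of_nonneg_left (by nlinarith [pow_nonneg hB0.le (d kp - e), hkp.2]) (pow_nonneg hB0.le _)
  -- extreme value theorem on `[A, B]`
  have hcont : ContinuousOn φ (Set.Icc A B) := fun u hu =>
    (Passage.hasDerivAt_quadForm_div_pow e e d J P v (hA0.trans_le hu.1)).continuousAt.continuousWithinAt
  obtain ⟨τ, hτmem, hτmin⟩ :=
    (isCompact_Icc : IsCompact (Set.Icc A B)).exists_isMinOn ⟨u₀, hAu₀.le, hu₀B.le⟩ hcont
  have hφu₀ : φ u₀ < 0 := by
    simp only [hφ]; exact div_neg_of_neg_of_pos hneg (pow_pos hu₀ _)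
  have hφτ : φ τ < 0 := (hτmin ⟨hAu₀.le, hu₀B.le⟩).trans_lt hφu₀
  have hτA : A < τ := lt_of_le_of_ne hτmem.1 fun h => by rw [← h] at hφτ; exact absurd hφA (not_le.2 hφτ)
  have hτB : τ < B := lt_of_le_of_ne hτmem.2 fun h => by rw [h] at hφτ; exact absurd hφB (not_le.2 hφτ)
  have hτ0 : 0 < τ := hA0.trans hτA
  refine ⟨τ, hτ0, ?_, (hτmin.isLocalMin (Icc_mem_nhds hτA hτB)).deriv_eq_zero⟩
  have : φ τ * τ ^ e = dotProduct v ((τ ^ e • J + ∑ k, τ ^ d k • P k).mulVec v) := by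
    simp only [hφ]; rw [div_mul_cancel₀ _ (pow_ne_zero e hτ0.ne')]
  rw [← this]
  exact mul_neg_of_neg_of_pos hφτ (pow_pos hτ0 _)

/-- **ISLAND ⟹ OVERLAP.**  `P k ⪰ 0`, levels `Dm < e < Dp` with `Dm ≤ d k ≤ Dp` and `d k ≠ e` for all `k`
(letters at the pivot exponent can be merged into `J`).  If `v` is a negative direction of `F(u₀)` for some
`u₀ > 0`, then at some `u > 0` the `Dp`-deflated pencil is negative on `v` and the `Dm`-deflated pencil is
positive on `v` (the top- and bottom-deflated pivot pencils are simultaneously negative on `v`). -/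
theorem exists_overlap_of_neg (e Dm Dp : ℕ) (d : Fin K → ℕ) (J : Matrix (Fin 2) (Fin 2) ℝ)
    (P : Fin K → Matrix (Fin 2) (Fin 2) ℝ) (hP : ∀ k, (P k).PosSemidef) (hDm : Dm < e) (hDp : e < Dp)
    (hd : ∀ k, Dm ≤ d k ∧ d k ≤ Dp) (hde : ∀ k, d k ≠ e) (v : Fin 2 → ℝ) {u₀ : ℝ} (hu₀ : 0 < u₀)
    (hneg : dotProduct v ((u₀ ^ e • J + ∑ k, u₀ ^ d k • P k).mulVec v) < 0) :
    ∃ u : ℝ, 0 < u ∧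
      dotProduct v (((((Dp : ℝ) - e) * u ^ e) • J + ∑ k, (((Dp : ℝ) - d k) * u ^ d k) • P k).mulVec v) < 0 ∧
      0 < dotProduct v (((((Dm : ℝ) - e) * u ^ e) • J + ∑ k, (((Dm : ℝ) - d k) * u ^ d k) • P k).mulVec v) := by
  set cJ := dotProduct v (J.mulVec v) with hcJdef
  set c : Fin K → ℝ := fun k => dotProduct v ((P k).mulVec v) with hcdef
  have hc : ∀ k, 0 ≤ c k := fun k => by simpa only [hcdef, star_trivial] using (hP k).dotProduct_mulVec_nonneg v
  have hcJ : cJ < 0 := by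
    rw [quadForm_pencil_eq] at hneg
    have : 0 ≤ ∑ k, u₀ ^ d k * c k := Finset.sum_nonneg fun k _ => mul_nonneg (pow_nonneg hu₀.le _) (hc k)
    by_contra h
    linarith [mul_nonneg (pow_nonneg hu₀.le e) (not_lt.1 h)]
  simp only [quadForm_deflate_eq]
  by_cases hup : ∃ k, e < d k ∧ 0 < c k
  · by_cases hdown : ∃ k, d k < e ∧ 0 < c k
    · -- both sides charged: the interior minimiser
      obtain ⟨kp, hkp⟩ := hup
      obtain ⟨km, hkm⟩ := hdown
      obtain ⟨τ, hτ0, hτneg, hτstat⟩ := exists_stationary_neg e d J P hP v kp km hkp hkm hu₀ hneg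
      refine ⟨τ, hτ0, ?_, ?_⟩
      · have h := quadForm_deflate_of_stationary e Dp d J P v hτ0 hτstat
        rw [quadForm_deflate_eq] at h
        rw [h]
        exact mul_neg_of_pos_of_neg (sub_pos.2 (by exact_mod_cast hDp)) hτneg
      · have h := quadForm_deflate_of_stationary e Dm d J P v hτ0 hτstat
        rw [quadForm_deflate_eq] at h
        rw [h]
        exact mul_pos_of_neg_of_neg (sub_neg.2 (by exact_mod_cast hDm)) hτneg
    · -- nothing charged below: small `u`
      push Not at hdown
      have hhigh : ∀ k, c k = 0 ∨ e + 1 ≤ d k := fun k => by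
        rcases (hc k).eq_or_lt with h0 | hpos
        · exact Or.inl h0.symm
        · right
          have h1 := hdown k
          have h2 := hde k
          by_contra h3
          exact absurd hpos (not_lt.2 (h1 (by omega)))
      exact scalar_overlap_near e Dm Dp d cJ c hc hcJ hDm hDp hd hhigh
  · -- nothing charged above: large `u`
    push Not at hup
    have hlow : ∀ k, c k = 0 ∨ d k ≤ e - 1 := fun k => by
      rcases (hc k).eq_or_lt with h0 | hpos
      · exact Or.inl h0.symm
      · right
        have h1 := hup k
        have h2 := hde k
        by_contra h3
        exact absurd hpos (not_lt.2 (h1 (by omega)))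
    exact scalar_overlap_far e Dm Dp d cJ c hc hcJ hDm hDp hd hlow

end Summit.ValiantsHypothesis.ValiantsHypothesis.Theorems.LacunarySymmetroidMatrixDescartes.Pivot.Overlap
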